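import Literature.Analysis.FluidPDE.StretchedLayerStripIdentities
import Literature.Analysis.FluidPDE.StretchedLayerEnergyClass
import HarnessLib

/-!
# The basic energy inequality on the period strip for a decaying perturbation of the stretched
# layer system

Analysis/FluidPDE file (one theorem, everything proved; the hypothesis structure
`StretchedLayer.StripEnergyHypotheses` is in `StretchedLayerEnergyClass`). This is
Majda–Bertozzi's basic energy estimate (*Vorticity and Incompressible Flow*, CUP 2002, §3.1.1,
eq. (3.5) and Prop. 3.1, p. 87–88) in the form of the Remark after Prop. 3.4 (p. 93: energy
estimates, hence uniqueness, for a perturbation of *finite* energy of a background flow that need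
not decay), written for the stretched two-dimensional Navier–Stokes layer system of
`StretchedLayerNS` on the period strip `(0, L] × ℝ`.

Fix a time. Let `(a, b)` be a divergence-free `C²` perturbation velocity with pressure `p`,
transported by a divergence-free `C¹` field `(U, V)` with the strain drift `−γy ∂_y`, and strained
by the gradient of a `C¹` field `(u, v)`:

  `a' + U ∂ₓa + (V − γy) ∂_ya + a ∂ₓu + b ∂_yu       = −∂ₓp + νΔa`,
  `b' + U ∂ₓb + (V − γy) ∂_yb + a ∂ₓv + b ∂_yv − γ b = −∂_yp + νΔb`,     `∂ₓa + ∂_yb = 0`,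

where `a', b'` are plane fields standing for the time derivatives (this is exactly the system
satisfied by the difference of two solutions `(u¹, v¹, p¹)`, `(u², v², p²)` of
`IsStretchedLayerNSSolutionOn` with `(U, V) = (u¹, v¹)`, `(u, v) = (u², v²)`). Everything is
`L`-periodic in `x`; `a, b, ∂ₓa, ∂ₓb` decay across the layer like `e^{−k|y|}`; `∂_y(a, b)`, the
pure second derivatives of `(a, b)`, `U, V, ∂ₓU, ∂_yV` are bounded; `p` grows at most
quadratically and `∇p` at most linearly in `y` (`StripEnergyHypotheses`). Then
(`StripEnergyHypotheses.integral_mul_add_mul_le`)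

  `∫∫_{(0,L]×ℝ} (a a' + b b') ≤ (2C + γ) ∫∫_{(0,L]×ℝ} (a² + b²)`,   `C = sup |∇(u, v)|`,

i.e. `E' ≤ 2(2C + γ)E` for `E = ½‖(a,b)‖²_{L²(strip)}` once `a', b'` are honest time derivatives.
Proof as printed: pair the equations with `(a, b)`; the transport term is
`−∫∫ (U ∂ₓφ + (V − γy)∂_yφ) = −γ∫∫φ ≤ 0`, `φ = ½(a² + b²)` (`integral_strip_transport`); the
strain term is `≤ 2C ∫∫(a² + b²)`; the stretching term `γ∫∫b² ≤ γ∫∫(a² + b²)`; the pressure term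
vanishes (`integral_strip_pressure_eq_zero`); the viscous term is `≤ 0`
(`integral_strip_mul_lap_self_nonpos`), `ν ≥ 0`.

## References

* A. J. Majda, A. L. Bertozzi, *Vorticity and Incompressible Flow*, CUP 2002, §3.1.1 eq. (3.5),
  Prop. 3.1, Cor. 3.1 (p. 87–88); §3.1.3 Remark after Prop. 3.4 (p. 93). [MajdaBertozzi2002]
-/

noncomputable section

open Set Function Filter
open _root_.MeasureTheory
open scoped Topology

namespace Literature.Analysis.FluidPDE

namespace StretchedLayer

/-- Products of bounded factors: `|g₁| ≤ M₁`, `|g₂| ≤ M₂` give `|g₁ g₂| ≤ M₁ M₂` (private copy;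
a public version is `Literature.Analysis.FluidPDE.CompressibleEuler.abs_mul_le_of_le`, not in this
import closure). [folklore] -/
private theorem abs_mul_le_mul_of_abs_le {g₁ g₂ M₁ M₂ : ℝ} (h₁ : |g₁| ≤ M₁) (h₂ : |g₂| ≤ M₂) :
    |g₁ * g₂| ≤ M₁ * M₂ := by
  rw [abs_mul]
  exact mul_le_mul h₁ h₂ (abs_nonneg _) ((abs_nonneg _).trans h₁)

/-- **The basic energy inequality on the period strip** (Majda–Bertozzi 2002, §3.1.1 eq. (3.5) /
Prop. 3.1, in the finite-energy-perturbation form of the Remark after Prop. 3.4): under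
`StripEnergyHypotheses L γ ν U V u v a b p a' b'` with `0 ≤ L`, `0 ≤ γ`, `0 ≤ ν` and
`|∂ₓu|, |∂_yu|, |∂ₓv|, |∂_yv| ≤ C`,
`∫∫_{(0,L]×ℝ} (a a' + b b') ≤ (2C + γ) ∫∫_{(0,L]×ℝ} (a² + b²)`.
Proof as printed: transport `−γ∫∫½(a²+b²) ≤ 0`, strain `≤ 2C∫∫(a²+b²)`, stretching
`γ∫∫b² ≤ γ∫∫(a²+b²)`, pressure `0`, viscosity `≤ 0`. [folklore] -/
theorem StripEnergyHypotheses.integral_mul_add_mul_le {L γ ν : ℝ}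
    {U V u v a b p a' b' : ℝ → ℝ → ℝ} (h : StripEnergyHypotheses L γ ν U V u v a b p a' b')
    (hL : 0 ≤ L) (hγ : 0 ≤ γ) (hν : 0 ≤ ν) {C : ℝ}
    (hC : ∀ x y, |dX u x y| ≤ C ∧ |dY u x y| ≤ C ∧ |dX v x y| ≤ C ∧ |dY v x y| ≤ C) :
    ∫ q in Ioc 0 L ×ˢ univ, (a q.1 q.2 * a' q.1 q.2 + b q.1 q.2 * b' q.1 q.2) ≤
      (2 * C + γ) * ∫ q in Ioc 0 L ×ˢ univ, (a q.1 q.2 ^ 2 + b q.1 q.2 ^ 2) := by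
  obtain ⟨k, A, hk, hA, hdec⟩ := h.decay
  obtain ⟨B₁, hB₁⟩ := h.bounded_dY
  obtain ⟨B₂, hB₂⟩ := h.bounded_dd
  obtain ⟨B₃, hB₃⟩ := h.bounded_UV
  obtain ⟨Q, hQ⟩ := h.pressure
  have hB₁0 : 0 ≤ B₁ := (abs_nonneg _).trans (hB₁ 0 0).1
  have hB₂0 : 0 ≤ B₂ := (abs_nonneg _).trans (hB₂ 0 0).1
  have hB₃0 : 0 ≤ B₃ := (abs_nonneg _).trans (hB₃ 0 0).1
  have hC0 : 0 ≤ C := (abs_nonneg _).trans (hC 0 0).1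
  have hQ0 : 0 ≤ Q := by have := (abs_nonneg _).trans (hQ 0 0).1; simpa using this
  -- notation for the weight
  have he1 : ∀ y : ℝ, Real.exp (-k * |y|) ≤ 1 := fun y =>
    Real.exp_le_one_iff.2 (by nlinarith [abs_nonneg y, hk])
  -- atomic bounds
  have ha0 : ∀ x y, |a x y| ≤ A * Real.exp (-k * |y|) := fun x y => (hdec x y).1
  have hb0 : ∀ x y, |b x y| ≤ A * Real.exp (-k * |y|) := fun x y => (hdec x y).2.1
  have hax : ∀ x y, |dX a x y| ≤ A * Real.exp (-k * |y|) := fun x y => (hdec x y).2.2.1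
  have hbx : ∀ x y, |dX b x y| ≤ A * Real.exp (-k * |y|) := fun x y => (hdec x y).2.2.2
  have hby' : ∀ x y, |dY b x y| ≤ A * Real.exp (-k * |y|) := fun x y => by
    rw [show dY b x y = -dX a x y by linarith [h.divFree x y], abs_neg]; exact hax x y
  have haA : ∀ x y, |a x y| ≤ A := fun x y => (ha0 x y).trans (mul_le_of_le_one_right hA (he1 y))
  have hbA : ∀ x y, |b x y| ≤ A := fun x y => (hb0 x y).trans (mul_le_of_le_one_right hA (he1 y))
  have haxA : ∀ x y, |dX a x y| ≤ A := fun x y =>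
    (hax x y).trans (mul_le_of_le_one_right hA (he1 y))
  have hbxA : ∀ x y, |dX b x y| ≤ A := fun x y =>
    (hbx x y).trans (mul_le_of_le_one_right hA (he1 y))
  have hay : ∀ x y, |dY a x y| ≤ B₁ := fun x y => (hB₁ x y).1
  have hby : ∀ x y, |dY b x y| ≤ B₁ := fun x y => (hB₁ x y).2
  have hU : ∀ x y, |U x y| ≤ B₃ := fun x y => (hB₃ x y).1
  have hVγ : ∀ x y, |V x y - γ * y| ≤ (B₃ + |γ|) * (1 + |y|) ^ 2 := fun x y =>
    abs_le_mul_one_add_abs_sq_of_abs_le_linear y (by positivity)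
      (abs_sub_mul_le_linear y hB₃0 (hB₃ x y).2.1)
  have hUx : ∀ x y, |dX U x y| ≤ B₃ := fun x y => (hB₃ x y).2.2.1
  have hVyγ : ∀ x y, |dY V x y - γ| ≤ B₃ + |γ| := fun x y =>
    (abs_sub _ _).trans (add_le_add_left (hB₃ x y).2.2.2 _)
  have hlapa : ∀ x y, |lap a x y| ≤ 2 * B₂ := fun x y => by
    rw [lap_apply]
    exact (abs_add_le _ _).trans (by linarith [(hB₂ x y).1, (hB₂ x y).2.1])
  have hlapb : ∀ x y, |lap b x y| ≤ 2 * B₂ := fun x y => by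
    rw [lap_apply]
    exact (abs_add_le _ _).trans (by linarith [(hB₂ x y).2.2.1, (hB₂ x y).2.2.2])
  -- regularity / continuity atoms
  have ca1 : ContDiff ℝ 1 (fun q : ℝ × ℝ => a q.1 q.2) := h.contDiff_a.of_le one_le_two
  have cb1 : ContDiff ℝ 1 (fun q : ℝ × ℝ => b q.1 q.2) := h.contDiff_b.of_le one_le_two
  have ca : Continuous (fun q : ℝ × ℝ => a q.1 q.2) := h.contDiff_a.continuous
  have cb : Continuous (fun q : ℝ × ℝ => b q.1 q.2) := h.contDiff_b.continuous
  have cax := continuous_dX ca1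
  have cbx := continuous_dX cb1
  have cay := continuous_dY ca1
  have cby := continuous_dY cb1
  have cU : Continuous (fun q : ℝ × ℝ => U q.1 q.2) := h.contDiff_U.continuous
  have cV : Continuous (fun q : ℝ × ℝ => V q.1 q.2) := h.contDiff_V.continuous
  have cUx := continuous_dX h.contDiff_U
  have cVy := continuous_dY h.contDiff_V
  have cux := continuous_dX h.contDiff_u
  have cuy := continuous_dY h.contDiff_u
  have cvx := continuous_dX h.contDiff_v
  have cvy := continuous_dY h.contDiff_v
  have cp : Continuous (fun q : ℝ × ℝ => p q.1 q.2) := h.contDiff_p.continuous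
  have cpx := continuous_dX h.contDiff_p
  have cpy := continuous_dY h.contDiff_p
  have cVγ : Continuous (fun q : ℝ × ℝ => V q.1 q.2 - γ * q.2) :=
    cV.sub (continuous_const.mul continuous_snd)
  have clapa : Continuous (fun q : ℝ × ℝ => lap a q.1 q.2) := by
    simp only [lap_apply]; exact (continuous_dXdX h.contDiff_a).add (continuous_dYdY h.contDiff_a)
  have clapb : Continuous (fun q : ℝ × ℝ => lap b q.1 q.2) := by
    simp only [lap_apply]; exact (continuous_dXdX h.contDiff_b).add (continuous_dYdY h.contDiff_b)
  -- the energy density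
  set φ : ℝ → ℝ → ℝ := fun x y => (a x y * a x y + b x y * b x y) / 2 with hφ_def
  have hφ1 : ContDiff ℝ 1 (fun q : ℝ × ℝ => φ q.1 q.2) := contDiff_half_sq_add_sq ca1 cb1
  have cφ : Continuous (fun q : ℝ × ℝ => φ q.1 q.2) := hφ1.continuous
  have cφx := continuous_dX hφ1
  have cφy := continuous_dY hφ1
  have hφx : ∀ x y, dX φ x y = a x y * dX a x y + b x y * dX b x y := fun x y =>
    dX_half_sq_add_sq (hasDerivAt_dX_of_contDiff h.contDiff_a two_ne_zero x y).differentiableAt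
      (hasDerivAt_dX_of_contDiff h.contDiff_b two_ne_zero x y).differentiableAt
  have hφy : ∀ x y, dY φ x y = a x y * dY a x y + b x y * dY b x y := fun x y =>
    dY_half_sq_add_sq (hasDerivAt_dY_of_contDiff h.contDiff_a two_ne_zero x y).differentiableAt
      (hasDerivAt_dY_of_contDiff h.contDiff_b two_ne_zero x y).differentiableAt
  have hperφ : ∀ x y, φ (x + L) y = φ x y := fun x y => by
    simp only [hφ_def, h.periodic_a, h.periodic_b]
  have hφ0 : ∀ x y, |φ x y| ≤ A * A * Real.exp (-k * |y|) := fun x y => by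
    have h1 := abs_mul_le_mul_of_abs_le (haA x y) (ha0 x y)
    have h2 := abs_mul_le_mul_of_abs_le (hbA x y) (hb0 x y)
    simp only [hφ_def, abs_div, abs_two]
    have h3 := abs_add_le (a x y * a x y) (b x y * b x y)
    nlinarith [Real.exp_pos (-k * |y|)]
  have hφx0 : ∀ x y, |dX φ x y| ≤ 2 * A * A * Real.exp (-k * |y|) := fun x y => by
    rw [hφx]
    have h1 := abs_mul_le_mul_of_abs_le (haA x y) (hax x y)
    have h2 := abs_mul_le_mul_of_abs_le (hbA x y) (hbx x y)
    exact (abs_add_le _ _).trans (by nlinarith)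
  have hφy0 : ∀ x y, |dY φ x y| ≤ 2 * A * B₁ * Real.exp (-k * |y|) := fun x y => by
    rw [hφy]
    have h1 : |a x y * dY a x y| ≤ A * Real.exp (-k * |y|) * B₁ :=
      abs_mul_le_mul_of_abs_le (ha0 x y) (hay x y)
    have h2 : |b x y * dY b x y| ≤ A * Real.exp (-k * |y|) * B₁ :=
      abs_mul_le_mul_of_abs_le (hb0 x y) (hby x y)
    exact (abs_add_le _ _).trans (by nlinarith)
  -- integrability on the strip: transport
  have iT1 : IntegrableOn (fun q : ℝ × ℝ => U q.1 q.2 * dX φ q.1 q.2) (Ioc 0 L ×ˢ univ) :=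
    integrableOn_strip_of_abs_le_exp (cU.mul cφx) (by positivity : 0 ≤ B₃ * (2 * A * A)) hk
      fun x _ y => by
        have := abs_mul_le_mul_of_abs_le (hU x y) (hφx0 x y); linarith
  have iT2 : IntegrableOn (fun q : ℝ × ℝ => dX U q.1 q.2 * φ q.1 q.2) (Ioc 0 L ×ˢ univ) :=
    integrableOn_strip_of_abs_le_exp (cUx.mul cφ) (by positivity : 0 ≤ B₃ * (A * A)) hk
      fun x _ y => by
        have := abs_mul_le_mul_of_abs_le (hUx x y) (hφ0 x y); linarith
  have iT3 : IntegrableOn (fun q : ℝ × ℝ => (V q.1 q.2 - γ * q.2) * dY φ q.1 q.2)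
      (Ioc 0 L ×ˢ univ) :=
    integrableOn_strip_of_abs_le_sq_exp (cVγ.mul cφy) hk fun x _ y =>
      abs_mul_le_weight' y (by positivity) (hVγ x y) (hφy0 x y)
  have iT4 : IntegrableOn (fun q : ℝ × ℝ => (dY V q.1 q.2 - γ) * φ q.1 q.2) (Ioc 0 L ×ˢ univ) :=
    integrableOn_strip_of_abs_le_exp ((cVy.sub continuous_const).mul cφ)
      (by positivity : 0 ≤ (B₃ + |γ|) * (A * A)) hk fun x _ y => by
        have := abs_mul_le_mul_of_abs_le (hVyγ x y) (hφ0 x y); linarith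
  have iT5 : IntegrableOn (fun q : ℝ × ℝ => (V q.1 q.2 - γ * q.2) * φ q.1 q.2) (Ioc 0 L ×ˢ univ) :=
    integrableOn_strip_of_abs_le_sq_exp (cVγ.mul cφ) hk fun x _ y =>
      abs_mul_le_weight' y (by positivity) (hVγ x y) (hφ0 x y)
  -- integrability on the strip: pressure
  have iP1 : IntegrableOn (fun q : ℝ × ℝ => a q.1 q.2 * dX p q.1 q.2) (Ioc 0 L ×ˢ univ) :=
    integrableOn_strip_of_abs_le_sq_exp (ca.mul cpx) hk fun x _ y =>
      abs_mul_le_weight y hA (ha0 x y)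
        (abs_le_mul_one_add_abs_sq_of_abs_le_linear y hQ0 (hQ x y).2.1)
  have iP2 : IntegrableOn (fun q : ℝ × ℝ => dX a q.1 q.2 * p q.1 q.2) (Ioc 0 L ×ˢ univ) :=
    integrableOn_strip_of_abs_le_sq_exp (cax.mul cp) hk fun x _ y =>
      abs_mul_le_weight y hA (hax x y) (hQ x y).1
  have iP3 : IntegrableOn (fun q : ℝ × ℝ => b q.1 q.2 * dY p q.1 q.2) (Ioc 0 L ×ˢ univ) :=
    integrableOn_strip_of_abs_le_sq_exp (cb.mul cpy) hk fun x _ y =>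
      abs_mul_le_weight y hA (hb0 x y)
        (abs_le_mul_one_add_abs_sq_of_abs_le_linear y hQ0 (hQ x y).2.2)
  have iP4 : IntegrableOn (fun q : ℝ × ℝ => dY b q.1 q.2 * p q.1 q.2) (Ioc 0 L ×ˢ univ) :=
    integrableOn_strip_of_abs_le_sq_exp (cby.mul cp) hk fun x _ y =>
      abs_mul_le_weight y hA (hby' x y) (hQ x y).1
  have iP5 : IntegrableOn (fun q : ℝ × ℝ => b q.1 q.2 * p q.1 q.2) (Ioc 0 L ×ˢ univ) :=
    integrableOn_strip_of_abs_le_sq_exp (cb.mul cp) hk fun x _ y =>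
      abs_mul_le_weight y hA (hb0 x y) (hQ x y).1
  -- integrability on the strip: strain, energy, stretching, viscosity
  have iS : IntegrableOn (fun q : ℝ × ℝ => a q.1 q.2 * a q.1 q.2 * dX u q.1 q.2 +
      a q.1 q.2 * b q.1 q.2 * dY u q.1 q.2 + a q.1 q.2 * b q.1 q.2 * dX v q.1 q.2 +
      b q.1 q.2 * b q.1 q.2 * dY v q.1 q.2) (Ioc 0 L ×ˢ univ) :=
    integrableOn_strip_of_abs_le_exp
      (((((ca.mul ca).mul cux).add ((ca.mul cb).mul cuy)).add ((ca.mul cb).mul cvx)).add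
        ((cb.mul cb).mul cvy)) (by positivity : 0 ≤ 4 * (A * A * C)) hk fun x _ y => by
        have h1 := abs_mul_le_mul_of_abs_le (abs_mul_le_mul_of_abs_le (ha0 x y) (haA x y))
          (hC x y).1
        have h2 := abs_mul_le_mul_of_abs_le (abs_mul_le_mul_of_abs_le (ha0 x y) (hbA x y))
          (hC x y).2.1
        have h3 := abs_mul_le_mul_of_abs_le (abs_mul_le_mul_of_abs_le (ha0 x y) (hbA x y))
          (hC x y).2.2.1
        have h4 := abs_mul_le_mul_of_abs_le (abs_mul_le_mul_of_abs_le (hb0 x y) (hbA x y))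
          (hC x y).2.2.2
        refine ((abs_add_le _ _).trans (add_le_add ((abs_add_le _ _).trans (add_le_add
          ((abs_add_le _ _).trans (add_le_add h1 h2)) h3)) h4)).trans (le_of_eq ?_)
        ring
  have iE : IntegrableOn (fun q : ℝ × ℝ => a q.1 q.2 ^ 2 + b q.1 q.2 ^ 2) (Ioc 0 L ×ˢ univ) :=
    integrableOn_strip_of_abs_le_exp ((ca.pow 2).add (cb.pow 2))
      (by positivity : 0 ≤ 2 * (A * A)) hk fun x _ y => by
        have h1 := abs_mul_le_mul_of_abs_le (haA x y) (ha0 x y)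
        have h2 := abs_mul_le_mul_of_abs_le (hbA x y) (hb0 x y)
        rw [abs_of_nonneg (by positivity), sq, sq]
        have h3 := le_abs_self (a x y * a x y)
        have h4 := le_abs_self (b x y * b x y)
        linarith
  have ibb : IntegrableOn (fun q : ℝ × ℝ => b q.1 q.2 * b q.1 q.2) (Ioc 0 L ×ˢ univ) :=
    integrableOn_strip_of_abs_le_exp (cb.mul cb) (by positivity : 0 ≤ A * A) hk fun x _ y => by
      have := abs_mul_le_mul_of_abs_le (hbA x y) (hb0 x y); linarith
  have iWa : IntegrableOn (fun q : ℝ × ℝ => a q.1 q.2 * lap a q.1 q.2) (Ioc 0 L ×ˢ univ) :=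
    integrableOn_strip_of_abs_le_exp (ca.mul clapa) (by positivity : 0 ≤ A * (2 * B₂)) hk
      fun x _ y => by have := abs_mul_le_mul_of_abs_le (ha0 x y) (hlapa x y); linarith
  have iWb : IntegrableOn (fun q : ℝ × ℝ => b q.1 q.2 * lap b q.1 q.2) (Ioc 0 L ×ˢ univ) :=
    integrableOn_strip_of_abs_le_exp (cb.mul clapb) (by positivity : 0 ≤ A * (2 * B₂)) hk
      fun x _ y => by have := abs_mul_le_mul_of_abs_le (hb0 x y) (hlapb x y); linarith
  -- the five terms
  have hT : ∫ q in Ioc 0 L ×ˢ univ,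
      (U q.1 q.2 * dX φ q.1 q.2 + (V q.1 q.2 - γ * q.2) * dY φ q.1 q.2) =
      γ * ∫ q in Ioc 0 L ×ˢ univ, φ q.1 q.2 :=
    integral_strip_transport hL h.contDiff_U h.contDiff_V hφ1 h.divFree_UV h.periodic_U hperφ
      iT1 iT2 iT3 iT4 iT5
  have hφE : ∫ q in Ioc 0 L ×ˢ univ, φ q.1 q.2 =
      (1 / 2) * ∫ q in Ioc 0 L ×ˢ univ, (a q.1 q.2 ^ 2 + b q.1 q.2 ^ 2) := by
    rw [← MeasureTheory.integral_const_mul]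
    refine integral_congr_ae (Eventually.of_forall fun q => ?_)
    simp only [hφ_def]
    ring
  have hE0 : 0 ≤ ∫ q in Ioc 0 L ×ˢ univ, (a q.1 q.2 ^ 2 + b q.1 q.2 ^ 2) :=
    setIntegral_nonneg (measurableSet_Ioc.prod MeasurableSet.univ) fun q _ => by positivity
  have hS : ∫ q in Ioc 0 L ×ˢ univ, -(a q.1 q.2 * a q.1 q.2 * dX u q.1 q.2 +
      a q.1 q.2 * b q.1 q.2 * dY u q.1 q.2 + a q.1 q.2 * b q.1 q.2 * dX v q.1 q.2 +
      b q.1 q.2 * b q.1 q.2 * dY v q.1 q.2) ≤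
      ∫ q in Ioc 0 L ×ˢ univ, 2 * C * (a q.1 q.2 ^ 2 + b q.1 q.2 ^ 2) := by
    refine integral_mono iS.neg (iE.const_mul (2 * C)) fun q => ?_
    obtain ⟨h1, h2, h3, h4⟩ := hC q.1 q.2
    simp only
    rw [abs_le] at h1 h2 h3 h4
    nlinarith [sq_nonneg (a q.1 q.2), sq_nonneg (b q.1 q.2), sq_nonneg (a q.1 q.2 + b q.1 q.2),
      sq_nonneg (a q.1 q.2 - b q.1 q.2), abs_nonneg (a q.1 q.2 * b q.1 q.2),
      mul_self_nonneg (a q.1 q.2), mul_self_nonneg (b q.1 q.2),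
      abs_mul_abs_self (a q.1 q.2), sq_abs (a q.1 q.2), sq_abs (b q.1 q.2)]
  have hSt : ∫ q in Ioc 0 L ×ˢ univ, b q.1 q.2 * b q.1 q.2 ≤
      ∫ q in Ioc 0 L ×ˢ univ, (a q.1 q.2 ^ 2 + b q.1 q.2 ^ 2) :=
    integral_mono ibb iE fun q => by simp only; nlinarith [sq_nonneg (a q.1 q.2)]
  have hP : ∫ q in Ioc 0 L ×ˢ univ, (a q.1 q.2 * dX p q.1 q.2 + b q.1 q.2 * dY p q.1 q.2) = 0 :=
    integral_strip_pressure_eq_zero hL ca1 cb1 h.contDiff_p h.divFree h.periodic_a h.periodic_p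
      iP1 iP2 iP3 iP4 iP5
  have hWa : ∫ q in Ioc 0 L ×ˢ univ, a q.1 q.2 * lap a q.1 q.2 ≤ 0 :=
    integral_strip_mul_lap_self_nonpos hL h.contDiff_a h.periodic_a hk hA ha0 hax fun x y =>
      add_le_add (add_le_add (hay x y) (hB₂ x y).1) (hB₂ x y).2.1
  have hWb : ∫ q in Ioc 0 L ×ˢ univ, b q.1 q.2 * lap b q.1 q.2 ≤ 0 :=
    integral_strip_mul_lap_self_nonpos hL h.contDiff_b h.periodic_b hk hA hb0 hbx fun x y =>
      add_le_add (add_le_add (hby x y) (hB₂ x y).2.2.1) (hB₂ x y).2.2.2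
  -- pair the equations with `(a, b)` and integrate
  have hpt : ∀ q : ℝ × ℝ, a q.1 q.2 * a' q.1 q.2 + b q.1 q.2 * b' q.1 q.2 =
      -(U q.1 q.2 * dX φ q.1 q.2 + (V q.1 q.2 - γ * q.2) * dY φ q.1 q.2)
      - (a q.1 q.2 * a q.1 q.2 * dX u q.1 q.2 + a q.1 q.2 * b q.1 q.2 * dY u q.1 q.2 +
          a q.1 q.2 * b q.1 q.2 * dX v q.1 q.2 + b q.1 q.2 * b q.1 q.2 * dY v q.1 q.2)
      + γ * (b q.1 q.2 * b q.1 q.2)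
      - (a q.1 q.2 * dX p q.1 q.2 + b q.1 q.2 * dY p q.1 q.2)
      + ν * (a q.1 q.2 * lap a q.1 q.2 + b q.1 q.2 * lap b q.1 q.2) := by
    intro q
    rw [hφx, hφy]
    linear_combination (a q.1 q.2) * h.eq_a q.1 q.2 + (b q.1 q.2) * h.eq_b q.1 q.2
  have iT : IntegrableOn (fun q : ℝ × ℝ =>
      U q.1 q.2 * dX φ q.1 q.2 + (V q.1 q.2 - γ * q.2) * dY φ q.1 q.2) (Ioc 0 L ×ˢ univ) :=
    iT1.add iT3
  have iP : IntegrableOn (fun q : ℝ × ℝ =>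
      a q.1 q.2 * dX p q.1 q.2 + b q.1 q.2 * dY p q.1 q.2) (Ioc 0 L ×ˢ univ) := iP1.add iP3
  have iW : IntegrableOn (fun q : ℝ × ℝ =>
      a q.1 q.2 * lap a q.1 q.2 + b q.1 q.2 * lap b q.1 q.2) (Ioc 0 L ×ˢ univ) := iWa.add iWb
  have i1 : IntegrableOn (fun q : ℝ × ℝ =>
      -(U q.1 q.2 * dX φ q.1 q.2 + (V q.1 q.2 - γ * q.2) * dY φ q.1 q.2)) (Ioc 0 L ×ˢ univ) :=
    iT.neg
  have i2 : IntegrableOn (fun q : ℝ × ℝ =>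
      -(U q.1 q.2 * dX φ q.1 q.2 + (V q.1 q.2 - γ * q.2) * dY φ q.1 q.2)
      - (a q.1 q.2 * a q.1 q.2 * dX u q.1 q.2 + a q.1 q.2 * b q.1 q.2 * dY u q.1 q.2 +
          a q.1 q.2 * b q.1 q.2 * dX v q.1 q.2 + b q.1 q.2 * b q.1 q.2 * dY v q.1 q.2))
      (Ioc 0 L ×ˢ univ) := i1.sub iS
  have ibbγ : IntegrableOn (fun q : ℝ × ℝ => γ * (b q.1 q.2 * b q.1 q.2)) (Ioc 0 L ×ˢ univ) :=
    ibb.const_mul γ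
  have i3 : IntegrableOn (fun q : ℝ × ℝ =>
      -(U q.1 q.2 * dX φ q.1 q.2 + (V q.1 q.2 - γ * q.2) * dY φ q.1 q.2)
      - (a q.1 q.2 * a q.1 q.2 * dX u q.1 q.2 + a q.1 q.2 * b q.1 q.2 * dY u q.1 q.2 +
          a q.1 q.2 * b q.1 q.2 * dX v q.1 q.2 + b q.1 q.2 * b q.1 q.2 * dY v q.1 q.2)
      + γ * (b q.1 q.2 * b q.1 q.2)) (Ioc 0 L ×ˢ univ) := i2.add ibbγ
  have i4 : IntegrableOn (fun q : ℝ × ℝ =>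
      -(U q.1 q.2 * dX φ q.1 q.2 + (V q.1 q.2 - γ * q.2) * dY φ q.1 q.2)
      - (a q.1 q.2 * a q.1 q.2 * dX u q.1 q.2 + a q.1 q.2 * b q.1 q.2 * dY u q.1 q.2 +
          a q.1 q.2 * b q.1 q.2 * dX v q.1 q.2 + b q.1 q.2 * b q.1 q.2 * dY v q.1 q.2)
      + γ * (b q.1 q.2 * b q.1 q.2)
      - (a q.1 q.2 * dX p q.1 q.2 + b q.1 q.2 * dY p q.1 q.2)) (Ioc 0 L ×ˢ univ) := i3.sub iP
  have i5 : IntegrableOn (fun q : ℝ × ℝ =>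
      ν * (a q.1 q.2 * lap a q.1 q.2 + b q.1 q.2 * lap b q.1 q.2)) (Ioc 0 L ×ˢ univ) :=
    iW.const_mul ν
  have hsplit : ∫ q in Ioc 0 L ×ˢ univ, (a q.1 q.2 * a' q.1 q.2 + b q.1 q.2 * b' q.1 q.2) =
      -(∫ q in Ioc 0 L ×ˢ univ, (U q.1 q.2 * dX φ q.1 q.2 + (V q.1 q.2 - γ * q.2) * dY φ q.1 q.2))
      - (∫ q in Ioc 0 L ×ˢ univ, (a q.1 q.2 * a q.1 q.2 * dX u q.1 q.2 +
          a q.1 q.2 * b q.1 q.2 * dY u q.1 q.2 + a q.1 q.2 * b q.1 q.2 * dX v q.1 q.2 +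
          b q.1 q.2 * b q.1 q.2 * dY v q.1 q.2))
      + γ * (∫ q in Ioc 0 L ×ˢ univ, b q.1 q.2 * b q.1 q.2)
      - (∫ q in Ioc 0 L ×ˢ univ, (a q.1 q.2 * dX p q.1 q.2 + b q.1 q.2 * dY p q.1 q.2))
      + ν * ((∫ q in Ioc 0 L ×ˢ univ, a q.1 q.2 * lap a q.1 q.2) +
          ∫ q in Ioc 0 L ×ˢ univ, b q.1 q.2 * lap b q.1 q.2) := by
    rw [integral_congr_ae (Eventually.of_forall hpt), integral_add i4 i5, integral_sub i3 iP,
      integral_add i2 ibbγ, integral_sub i1 iS, MeasureTheory.integral_neg,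
      MeasureTheory.integral_const_mul, MeasureTheory.integral_const_mul, integral_add iWa iWb]
  have hSn : ∫ q in Ioc 0 L ×ˢ univ, -(a q.1 q.2 * a q.1 q.2 * dX u q.1 q.2 +
      a q.1 q.2 * b q.1 q.2 * dY u q.1 q.2 + a q.1 q.2 * b q.1 q.2 * dX v q.1 q.2 +
      b q.1 q.2 * b q.1 q.2 * dY v q.1 q.2) =
      -∫ q in Ioc 0 L ×ˢ univ, (a q.1 q.2 * a q.1 q.2 * dX u q.1 q.2 +
      a q.1 q.2 * b q.1 q.2 * dY u q.1 q.2 + a q.1 q.2 * b q.1 q.2 * dX v q.1 q.2 +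
      b q.1 q.2 * b q.1 q.2 * dY v q.1 q.2) := MeasureTheory.integral_neg _
  have h2C : ∫ q in Ioc 0 L ×ˢ univ, 2 * C * (a q.1 q.2 ^ 2 + b q.1 q.2 ^ 2) =
      2 * C * ∫ q in Ioc 0 L ×ˢ univ, (a q.1 q.2 ^ 2 + b q.1 q.2 ^ 2) :=
    MeasureTheory.integral_const_mul _ _
  rw [hsplit, hT, hφE, hP]
  rw [hSn, h2C] at hS
  have hγE : 0 ≤ γ * (1 / 2 * ∫ q in Ioc 0 L ×ˢ univ, (a q.1 q.2 ^ 2 + b q.1 q.2 ^ 2)) := by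
    positivity
  have hνW : ν * ((∫ q in Ioc 0 L ×ˢ univ, a q.1 q.2 * lap a q.1 q.2) +
      ∫ q in Ioc 0 L ×ˢ univ, b q.1 q.2 * lap b q.1 q.2) ≤ 0 :=
    mul_nonpos_of_nonneg_of_nonpos hν (by linarith)
  have hγb := mul_le_mul_of_nonneg_left hSt hγ
  nlinarith

end StretchedLayer

end Literature.Analysis.FluidPDE
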